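import Summits.ResolutionOfSingularities.ResolutionOfSingularities.Theorems.RadicialJungCleanModelsCleanLU3CompositeFormOneLift
import Summits.ResolutionOfSingularities.ResolutionOfSingularities.Theorems.RadicialJungCleanModelsCcurvePointPrepWeak
import Summits.ResolutionOfSingularities.ResolutionOfSingularities.Theorems.FrobeniusClosingSteerShannonCoarseningLemmas
import Literature.AlgebraicGeometry.Resolution.QuadraticTransforms
import Literature.AlgebraicGeometry.Resolution.ValuationOverrings
import HarnessLib

/-!
# Route `RadicialJung`, crux `CleanModels` (stmt-15917) — (C-curve) sub-line: one step of the lift — the curve blow-up chart realises the quadratic transform along `O₁`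

Lead `res-B-lead-1` g6 (plan `Cruxes/CleanModels/Lines/Sketch-memo-Ccurve-plan.md` §1 S2–S4, brick for `stub_Cc_lift`; workfile `Lines/Sketch_Ccurve_assembly.lean` v2.7).
OURS · counted 0.  Nothing here proves resolution in characteristic `p`; resolution in char `p` is NOT proved.

`lift_step`: in the output situation of `stub_Cc_centreCurve` (model `B′` regular of dimension `3` at the centre of `O` with r.s.p. `(x, y, z)`, the centre of the
coarsening `O₁ ≥ O` on `S′ = locAtCentre B′ O` being EXACTLY `(x, y)`) and with `v x ≤ v y`, the model `B″ = B′[x/y]` (one blow-up of the regular centre curve,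
`v`-chart) is finitely generated, inside `O`, regular of dimension `3` at the centre of `O` (✓ `isRegularLocalRing_locAtCentre_curveChart`), and its local ring
at the centre of `O₁` is THE quadratic transform of `R₀ = locAtCentre B′ O₁` along `O₁` (`IsQuadraticTransformAlong`, Cutkosky §2.2): `𝔪_{R₀} = (x, y) R₀`,
`v₁ x ≤ v₁ y`, and `locAtCentre B″ O₁ = locAtCentre (R₀[x/y]) O₁` (✓ `PfaffLine.locAtCentre_closure_locAtCentre_union`).  Iterating this along Abhyankar's
factorisation (✓ `AbhyankarQuadraticFactorization_holds`) with `stub_Cc_centreCurve` in between is `stub_Cc_lift`.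
-/

noncomputable section

set_option linter.dupNamespace false

open IsLocalRing Literature.AlgebraicGeometry.Resolution
open Summit.ResolutionOfSingularities.ResolutionOfSingularities.Theorems
open Summit.ResolutionOfSingularities.ResolutionOfSingularities.Theorems.SwitchingDichotomy

namespace Summit.ResolutionOfSingularities.ResolutionOfSingularities.Theorems.RadicialJung.CleanModels.Ccurve

/-- **One step of the lift.**  See the module docstring. [folklore; cite: Cutkosky2014, §2.2] -/
theorem lift_step :
    ∀ (k : Type) [Field k] (K : Type) [Field K] [Algebra k K]
    (O : ValuationSubring K) (A : Subalgebra k K), A.toSubring ≤ O.toSubring → A.FG → IsFractionRing A K →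
    (∀ (T : Subring K) (hT : T ≤ O.toSubring), A.toSubring ≤ T → (subringCentre T O hT).IsMaximal) →
    ∀ (B' : Subalgebra k K) (hB'O : B'.toSubring ≤ O.toSubring), A ≤ B' → B'.FG →
    IsRegularLocalRing (locAtCentre B'.toSubring O) → ringKrullDim (locAtCentre B'.toSubring O) = 3 →
    ∀ (O₁ : ValuationSubring K), O ≤ O₁ →
    ∀ (x y z : K) (hx : x ∈ locAtCentre B'.toSubring O) (hy : y ∈ locAtCentre B'.toSubring O) (hz : z ∈ locAtCentre B'.toSubring O),
      (haveI := isLocalRing_locAtCentre hB'O; IsLocalRing.maximalIdeal (locAtCentre B'.toSubring O)) =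
        Ideal.span {⟨x, hx⟩, ⟨y, hy⟩, ⟨z, hz⟩} →
      (∀ w : ↥(locAtCentre B'.toSubring O), O₁.valuation (w : K) < 1 ↔ w ∈ Ideal.span {(⟨x, hx⟩ : ↥(locAtCentre B'.toSubring O)), ⟨y, hy⟩}) →
    O.valuation x ≤ O.valuation y →
    ∃ (B'' : Subalgebra k K) (_ : B''.toSubring ≤ O.toSubring), B' ≤ B'' ∧ B''.FG ∧
    IsRegularLocalRing (locAtCentre B''.toSubring O) ∧ ringKrullDim (locAtCentre B''.toSubring O) = 3 ∧
    B''.toSubring = Subring.closure ((B'.toSubring : Set K) ∪ {x / y}) ∧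
    IsQuadraticTransformAlong O₁ (locAtCentre B'.toSubring O₁) (locAtCentre B''.toSubring O₁) := by
  intro k _ K _ _ O A hAO hAfg hfrac hzd B' hB'O hAB' hB'fg hB'reg hB'dim O₁ hOO₁ x y z hx hy hz hmax hcen hv
  classical
  haveI := hfrac
  haveI := isLocalRing_locAtCentre hB'O
  haveI : IsRegularLocalRing ↥(locAtCentre B'.toSubring O) := hB'reg
  have hB'O₁ : B'.toSubring ≤ O₁.toSubring := fun w hw => hOO₁ (hB'O hw)
  haveI := isLocalRing_locAtCentre hB'O₁
  set R : Subring K := locAtCentre B'.toSubring O with hR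
  have hRO : R ≤ O.toSubring := locAtCentre_le hB'O
  have hd : (maximalIdeal ↥R).spanFinrank = 3 := spanFinrank_eq_three_of_dim _ hB'dim
  -- the model `B'' = B'[x/y]`
  obtain ⟨B'', hB''eq, hB'B'', hfg⟩ := exists_subalgebra_closure B' ({x / y} : Finset K)
  rw [Finset.coe_singleton] at hB''eq
  have hcl : Subring.closure ((R : Set K) ∪ {x / y}) ≤ O.toSubring := curveChart_le O R hRO _ _ hv
  have hB''le : B''.toSubring ≤ Subring.closure ((R : Set K) ∪ {x / y}) := by
    rw [hB''eq]
    exact Subring.closure_mono (Set.union_subset_union_left _ (le_locAtCentre B'.toSubring O))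
  have hB''O : B''.toSubring ≤ O.toSubring := hB''le.trans hcl
  -- regularity at the centre of `O`
  have hrange : Ideal.span (Set.range ![(⟨x, hx⟩ : ↥R), ⟨y, hy⟩, ⟨z, hz⟩]) = maximalIdeal ↥R := by
    rw [range_vec3]; exact hmax.symm
  have hreg := (isRegularLocalRing_locAtCentre_curveChart O R hRO hd ![(⟨x, hx⟩ : ↥R), ⟨y, hy⟩, ⟨z, hz⟩] hrange 0 1 (by decide) hv).1
  have hlocO : locAtCentre B''.toSubring O = locAtCentre (Subring.closure ((R : Set K) ∪ {x / y})) O := by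
    rw [hB''eq, hR, PfaffLine.locAtCentre_closure_locAtCentre_union]
  have hB''reg : IsRegularLocalRing ↥(locAtCentre B''.toSubring O) := by rw [hlocO]; exact hreg
  -- dimension `3`
  have hAB'' : A ≤ B'' := hAB'.trans hB'B''
  have hdimA3 : ringKrullDim ↥A = 3 := by
    rw [← ringKrullDim_eq_of_fg_of_le hAfg hB'fg hAB', ← ringKrullDim_locAtCentre_eq_of_isMaximal B' hB'fg O hB'O (hzd _ hB'O fun w hw => hAB' hw)]
    exact hB'dim
  have hB''fg : B''.FG := hfg hB'fg
  have hB''dim : ringKrullDim ↥(locAtCentre B''.toSubring O) = 3 := by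
    rw [ringKrullDim_locAtCentre_eq_of_isMaximal B'' hB''fg O hB''O (hzd _ hB''O fun w hw => hAB'' hw), ringKrullDim_eq_of_fg_of_le hAfg hB''fg hAB'', hdimA3]
  refine ⟨B'', hB''O, hB'B'', hB''fg, hB''reg, hB''dim, hB''eq, ?_⟩
  -- the quadratic transform along `O₁`
  set R₀ : Subring K := locAtCentre B'.toSubring O₁ with hR₀
  have hRR₀ : R ≤ R₀ := by
    rintro v ⟨a, ha, b, hb, hvb, rfl⟩
    exact ⟨a, ha, b, hb, Shannon.valuation_eq_one_of_le hOO₁ hvb, rfl⟩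
  have hxR₀ : x ∈ R₀ := hRR₀ hx
  have hyR₀ : y ∈ R₀ := hRR₀ hy
  have hy0 : y ≠ 0 := by
    intro h0
    have hmax' : maximalIdeal ↥R = Ideal.span {(⟨x, hx⟩ : ↥R), ⟨z, hz⟩, ⟨y, hy⟩} := by
      rw [hmax]; congr 1; ext v; simp only [Set.mem_insert_iff, Set.mem_singleton_iff]; tauto
    have := not_mem_span_pair_of_rsp hd (⟨x, hx⟩ : ↥R) ⟨z, hz⟩ ⟨y, hy⟩ hmax'
    apply this
    rw [show (⟨y, hy⟩ : ↥R) = 0 from Subtype.ext h0]; exact Ideal.zero_mem _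
  -- `𝔪_{R₀} = (x, y) R₀`
  have hmaxR₀ : Ideal.span ({⟨x, hxR₀⟩, ⟨y, hyR₀⟩} : Set ↥R₀) = maximalIdeal ↥R₀ := by
    apply le_antisymm
    · rw [Ideal.span_le]
      rintro w (rfl | rfl)
      · exact (mem_maximalIdeal_locAtCentre_iff hB'O₁ _).mpr ((hcen ⟨x, hx⟩).mpr (Ideal.subset_span (by simp)))
      · exact (mem_maximalIdeal_locAtCentre_iff hB'O₁ _).mpr ((hcen ⟨y, hy⟩).mpr (Ideal.subset_span (by simp)))
    · intro w hw
      rw [mem_maximalIdeal_locAtCentre_iff hB'O₁] at hw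
      obtain ⟨a, ha, b, hb, hvb, hwab⟩ := mem_locAtCentre_iff.mp w.2
      have hb0 : b ≠ 0 := ne_zero_of_valuation_eq_one hvb
      have haR : a ∈ R := le_locAtCentre _ _ ha
      have hva : O₁.valuation a < 1 := by
        have : a = (w : K) * b := by rw [hwab]; field_simp
        rw [this, map_mul]
        calc O₁.valuation (w : K) * O₁.valuation b ≤ O₁.valuation (w : K) * 1 := by
              gcongr; exact (O₁.valuation_le_one_iff _).mpr (hB'O₁ hb)
          _ < 1 := by rw [mul_one]; exact hw
      have hamem : (⟨a, haR⟩ : ↥R) ∈ Ideal.span ({⟨x, hx⟩, ⟨y, hy⟩} : Set ↥R) := (hcen ⟨a, haR⟩).mp hva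
      obtain ⟨r, s, hrs⟩ := Ideal.mem_span_pair.mp hamem
      have hrs' : (r : K) * x + (s : K) * y = a := by
        have := congrArg Subtype.val hrs; simpa using this
      have hbinv : b⁻¹ ∈ R₀ := inv_mem_locAtCentre (le_locAtCentre _ _ hb) hvb
      rw [Ideal.mem_span_pair]
      refine ⟨⟨(r : K) * b⁻¹, Subring.mul_mem _ (hRR₀ r.2) hbinv⟩, ⟨(s : K) * b⁻¹, Subring.mul_mem _ (hRR₀ s.2) hbinv⟩, Subtype.ext ?_⟩
      change (r : K) * b⁻¹ * x + (s : K) * b⁻¹ * y = (w : K)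
      rw [hwab, ← hrs']; field_simp
  refine ⟨isLocalRing_locAtCentre hB'O₁, locAtCentre_le hB'O₁, {⟨x, hxR₀⟩, ⟨y, hyR₀⟩}, ⟨y, hyR₀⟩, ?_, by simp,
    fun h => hy0 (congrArg Subtype.val h), ?_, ?_⟩
  · rw [Finset.coe_insert, Finset.coe_singleton]; exact hmaxR₀
  · intro w hw
    simp only [Finset.mem_insert, Finset.mem_singleton] at hw
    rcases hw with rfl | rfl
    · exact valuation_le_valuation_of_le hOO₁ hv
    · exact le_refl _
  · -- `locAtCentre B'' O₁ = locAtCentre (R₀[x/y]) O₁`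
    have himg : ((fun w : ↥R₀ => (w : K) / (⟨y, hyR₀⟩ : ↥R₀)) '' (↑({⟨x, hxR₀⟩, ⟨y, hyR₀⟩} : Finset ↥R₀) : Set ↥R₀)) = {x / y, 1} := by
      rw [Finset.coe_insert, Finset.coe_singleton, Set.image_insert_eq, Set.image_singleton]
      simp [div_self hy0]
    rw [himg]
    have hcl1 : Subring.closure ((R₀ : Set K) ∪ {x / y, 1}) = Subring.closure ((R₀ : Set K) ∪ {x / y}) := by
      apply le_antisymm
      · refine Subring.closure_le.mpr ?_
        rintro w (hw | rfl | rfl)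
        · exact Subring.subset_closure (Or.inl hw)
        · exact Subring.subset_closure (Or.inr rfl)
        · exact Subring.one_mem _
      · exact Subring.closure_mono (Set.union_subset_union_right _ (by simp))
    rw [hcl1, hR₀, PfaffLine.locAtCentre_closure_locAtCentre_union, hB''eq]

end Summit.ResolutionOfSingularities.ResolutionOfSingularities.Theorems.RadicialJung.CleanModels.Ccurve

end
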